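import Summits.QuantumFields.BalabanUV.Gaps.EndTopRunCriterion

/-!
# Gaps / EndTopRunCooperative — non-crossing BEYOND the Markov reading: COOPERATIVE history dependence (β_{k+1} non-decreasing in the earlier
# couplings g_0,…,g_{k−1} and with `x ↦ 1∕x² − β_{k+1}(…,x)` strictly decreasing in the last one) ⟹ in-interval runs of (0.20) do not cross ⟹
# the exact top-run criterion of `EndTopRunCriterion` applies to such HISTORY-DEPENDENT families
# (cell pub-balaban-gaps, seat g1-p3 gen 6, row CAP+tail ∕ β-currency «split ∕ weakening»; sequel of `Gaps/EndTopRunCriterion`)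

HONEST FRAMING (cell rule, page 1 of everything): [folklore] real analysis (an induction along two runs) over the tree's typed carriers
(`FlowStep.RGEqH` ∕ `Box` ∕ `prefixOf`, `DagBinding.ForwardGenerated` ∕ `EndpointExistence`, `FlowStepRuns.HaltsOutside` ∕ `CurriesHBeta`).  The
cooperative hypothesis is a BINDER on a history-dependent β-family ([I] p. 298: β_{k+1} «depends also on all preceding coupling constants»);
whether Bałaban's β-functions are cooperative is NOT asserted.  `EndpointExistence` appears only inside an equivalence.  NOTHING of Bałaban's is
asserted; 0∕6 binders; 0 coefficients certified; one finite T⁴; NOT B12 Thm 2, NOT `BetaPertH`, NOT the continuum limit, NOT Clay.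

THE POINT.  `EndTopRunCriterion` proves `EndpointExistence C ↔ «no backsliding from the top»` under NON-CROSSING of in-interval runs and supplies
non-crossing only for the MARKOV reading `β = ofMarkov βM` (`strictOrder_ofMarkov`, `anti_of_lipschitz`).  For a genuinely history-dependent
family the same induction goes through when the dependence on the EARLIER couplings is COOPERATIVE (monotone non-decreasing: larger past couplings
give a larger β, i.e. — by (0.20) `1∕g_{k+1}² = 1∕g_k² − β_{k+1}` — a LARGER next coupling; cooperative in Hirsch's sense) and the dependence on the
LAST coupling keeps each step map increasing
(`strictOrder_of_cooperative`): compare the two runs through the intermediate history «earlier couplings of the larger run, last coupling of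
the smaller».  Hence `endpointExistence_iff_topRuns_of_cooperative` (construction level) — the exact END criterion for cooperative families;
the Markov case is the sub-case «β ignores the earlier couplings»; v1.2 (APPEND-ONLY) §3: hypothesis (i) from a LIPSCHITZ LETTER `≤ 2∕γ³` on the
last-coupling sections (`anti_of_lastLipschitz`, `endpointExistence_iff_topRuns_of_cooperative_lipschitz`).  0 sorry; 0 def; imports `Gaps/EndTopRunCriterion` only; restates nothing.

CITATION HEADER (tags CONTEXT ONLY).  [I] = T. Bałaban, Commun. Math. Phys. **109** (1987) [Balaban1987RG1]: Thm 2 p. 259, (0.20) p. 256,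
§5 p. 298 («we write β_j as explicitly dependent on g_{j−1}, although it depends also on all preceding coupling constants»).
-/

namespace Summit.QuantumFields.BalabanUV.Gaps.EndTopRunCooperative

open Literature.MathematicalPhysics.QuantumFieldTheory.Balaban1983to89
open Literature.MathematicalPhysics.QuantumFieldTheory.Balaban1983to89.FlowStep
open Literature.MathematicalPhysics.QuantumFieldTheory.Balaban1983to89.FlowStepRuns
open Literature.MathematicalPhysics.QuantumFieldTheory.Balaban1983to89.DagBinding
open Summit.QuantumFields.BalabanUV.Gaps.EndRunwiseShooting
open Summit.QuantumFields.BalabanUV.Gaps.EndTopRunCriterion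
open Finset

noncomputable section

variable {β : HBeta} {γ : ℝ}

/-! ## §1 Cooperative history dependence ⟹ non-crossing -/

/-- Replacing the last coupling of an in-box prefix by another point of `]0,γ]` stays in the box. [folklore] -/
theorem update_last_mem_box {k : ℕ} {v : Fin (k + 1) → ℝ} (hv : v ∈ Box γ k) {x : ℝ} (hx : 0 < x) (hxγ : x ≤ γ) :
    Function.update v (Fin.last k) x ∈ Box γ k := by
  rw [mem_box] at hv ⊢
  intro i
  by_cases hi : i = Fin.last k
  · subst hi; simpa using And.intro hx hxγ
  · rw [Function.update_of_ne hi]; exact hv i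

/-- **NON-CROSSING FOR COOPERATIVE FAMILIES.**  Hypotheses on the history-dependent family `β` at level `γ`: (i) in the LAST coupling each step map
is increasing — for every in-box prefix `v` and `0 < x < y ≤ γ`, `1∕y² − β_{k+1}(v|_{last := y}) < 1∕x² − β_{k+1}(v|_{last := x})` (e.g. Lipschitz
with constant `≤ 2∕γ³`, cf. `EndTopRunCriterion.anti_of_lipschitz`); (ii) COOPERATIVE in the EARLIER couplings — for in-box prefixes `v ≤ v′`
coordinatewise with the same last coupling, `β_{k+1}(v) ≤ β_{k+1}(v′)`.  Then two in-interval solutions of (0.20) with `g_0 < g′_0` satisfy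
`g_k < g′_k` for every `k ≤ n`: compare through the intermediate prefix `(g′_0,…,g′_{k−1}, g_k)`. [cite: Balaban1987RG1, (0.20) p.256 and §5 p.298] -/
theorem strictOrder_of_cooperative
    (hanti : ∀ (k : ℕ) (v : Fin (k + 1) → ℝ), v ∈ Box γ k → ∀ x y : ℝ, 0 < x → x < y → y ≤ γ →
      1 / y ^ 2 - β k (Function.update v (Fin.last k) y) < 1 / x ^ 2 - β k (Function.update v (Fin.last k) x))
    (hcoop : ∀ (k : ℕ) (v v' : Fin (k + 1) → ℝ), v ∈ Box γ k → v' ∈ Box γ k → (∀ i, v i ≤ v' i) →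
      v (Fin.last k) = v' (Fin.last k) → β k v ≤ β k v')
    {n : ℕ} {gs gs' : ℕ → ℝ} (hrg : RGEqH n β gs) (hrg' : RGEqH n β gs')
    (hI : Step.InInterval γ n gs) (hI' : Step.InInterval γ n gs') (h0 : gs 0 < gs' 0) :
    ∀ k, k ≤ n → gs k < gs' k := by
  -- strong form: all earlier couplings ordered
  suffices H : ∀ k, k ≤ n → ∀ i, i ≤ k → gs i < gs' i from fun k hk => H k hk k le_rfl
  intro k
  induction k with
  | zero => intro _ i hi; obtain rfl := Nat.le_zero.mp hi; exact h0
  | succ k ih =>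
    intro hk i hi
    rcases Nat.lt_or_eq_of_le hi with hlt | rfl
    · exact ih (Nat.le_of_succ_le hk) i (Nat.lt_succ_iff.mp hlt)
    · have hprev := ih (Nat.le_of_succ_le hk)
      have hkn : k < n := Nat.lt_of_succ_le hk
      -- the two prefixes and the intermediate one
      set v : Fin (k + 1) → ℝ := prefixOf gs k with hv
      set v' : Fin (k + 1) → ℝ := prefixOf gs' k with hv'
      set w : Fin (k + 1) → ℝ := Function.update v' (Fin.last k) (gs k) with hw
      have hvbox : v ∈ Box γ k := mem_box.mpr fun j => hI j ((Nat.lt_succ_iff.mp j.isLt).trans hkn.le)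
      have hv'box : v' ∈ Box γ k := mem_box.mpr fun j => hI' j ((Nat.lt_succ_iff.mp j.isLt).trans hkn.le)
      have hgk : 0 < gs k ∧ gs k ≤ γ := hI k hkn.le
      have hgk' : 0 < gs' k ∧ gs' k ≤ γ := hI' k hkn.le
      have hwbox : w ∈ Box γ k := update_last_mem_box hv'box hgk.1 hgk.2
      -- (ii) cooperative: β v ≤ β w
      have hvw : β k v ≤ β k w := by
        refine hcoop k v w hvbox hwbox (fun j => ?_) (by simp [hw, hv])
        by_cases hj : j = Fin.last k
        · subst hj; simp [hw, hv]
        · rw [hw, Function.update_of_ne hj]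
          have hjk : (j : ℕ) < k := lt_of_le_of_ne (Nat.lt_succ_iff.mp j.isLt) (fun h => hj (Fin.ext (by simp [h])))
          exact (hprev j hjk.le).le
      -- (i) anti in the last coupling at the earlier couplings of the larger run: compare `w` (last = g_k) with `v'` (last = g'_k)
      have hwv' : 1 / (gs' k) ^ 2 - β k v' < 1 / (gs k) ^ 2 - β k w := by
        have h := hanti k v' hv'box (gs k) (gs' k) hgk.1 (hprev k le_rfl) hgk'.2
        have e1 : Function.update v' (Fin.last k) (gs' k) = v' := by
          rw [hv']; exact Function.update_eq_self (Fin.last k) (prefixOf gs' k)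
        rwa [e1] at h
      -- the two recursion steps
      have e : 1 / (gs k) ^ 2 = 1 / (gs (k + 1)) ^ 2 + β k v := hrg k hkn
      have e' : 1 / (gs' k) ^ 2 = 1 / (gs' (k + 1)) ^ 2 + β k v' := hrg' k hkn
      have hinv : 1 / (gs' (k + 1)) ^ 2 < 1 / (gs (k + 1)) ^ 2 := by linarith
      have hp : 0 < gs (k + 1) := (hI (k + 1) hk).1
      have hp' : 0 < gs' (k + 1) := (hI' (k + 1) hk).1
      by_contra hle
      push Not at hle
      have : 1 / (gs (k + 1)) ^ 2 ≤ 1 / (gs' (k + 1)) ^ 2 :=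
        one_div_le_one_div_of_le (by positivity) (pow_le_pow_left₀ hp'.le hle 2)
      linarith

/-- The MARKOV reading is the sub-case «β ignores the earlier couplings»: for `β = ofMarkov βM` hypothesis (ii) holds with equality and (i) is
`EndTopRunCriterion.strictOrder_ofMarkov`'s `hanti`. [folklore] -/
theorem cooperative_ofMarkov (βM : ℕ → ℝ → ℝ) :
    ∀ (k : ℕ) (v v' : Fin (k + 1) → ℝ), v ∈ Box γ k → v' ∈ Box γ k → (∀ i, v i ≤ v' i) →
      v (Fin.last k) = v' (Fin.last k) → ofMarkov βM k v ≤ ofMarkov βM k v' := by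
  intro k v v' _ _ _ hlast
  simp [ofMarkov, hlast]

/-! ## §2 The exact END criterion for cooperative families -/

/-- **THE END CRITERION FOR COOPERATIVE HISTORY-DEPENDENT FAMILIES** (construction level; `ForwardGenerated`, `HaltsOutside`, `CurriesHBeta` — the
three modelling clauses of `FlowStepRuns`): `β` jointly continuous and `≤ β′` on `]0,γ₀]^{k+1}`, increasing step maps in the last coupling and
cooperative in the earlier ones (both at level `γ₀`, hence at every smaller level) ⟹
`EndpointExistence C ↔ ∃ γ₂ > 0, ∀ γ ≤ γ₂, ∃ g⋆ > 0, no in-interval run of (0.20) in ]0,γ] that sits at γ ends below g⋆`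
(= `EndTopRunCriterion.endpointExistence_iff_topRuns` with non-crossing supplied by `strictOrder_of_cooperative`). [cite: Balaban1987RG1, Thm 2 p.259] -/
theorem endpointExistence_iff_topRuns_of_cooperative {C : B12.Construction} {β : HBeta} (hgen : ForwardGenerated C β)
    (hhalt : HaltsOutside C β) (hcur : CurriesHBeta C β) {γ₀ β' : ℝ} (hγ₀ : 0 < γ₀) (hβ' : 0 ≤ β')
    (hcont : BetaContH γ₀ β) (hhi : BetaUpperH β' γ₀ β)
    (hanti : ∀ (k : ℕ) (v : Fin (k + 1) → ℝ), v ∈ Box γ₀ k → ∀ x y : ℝ, 0 < x → x < y → y ≤ γ₀ →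
      1 / y ^ 2 - β k (Function.update v (Fin.last k) y) < 1 / x ^ 2 - β k (Function.update v (Fin.last k) x))
    (hcoop : ∀ (k : ℕ) (v v' : Fin (k + 1) → ℝ), v ∈ Box γ₀ k → v' ∈ Box γ₀ k → (∀ i, v i ≤ v' i) →
      v (Fin.last k) = v' (Fin.last k) → β k v ≤ β k v') :
    EndpointExistence C ↔
      ∃ γ₂ : ℝ, 0 < γ₂ ∧ ∀ γ : ℝ, 0 < γ → γ ≤ γ₂ → ∃ gstar : ℝ, 0 < gstar ∧
        ∀ (n : ℕ) (gs : ℕ → ℝ), RGEqH n β gs → Step.InInterval γ n gs → ∀ k, k ≤ n → gs k = γ → gstar ≤ gs n := by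
  refine endpointExistence_iff_topRuns hgen hhalt hcur hγ₀ hβ' hcont hhi fun γ hγ hγle => ?_
  -- restrict (i), (ii) to the level `γ ≤ γ₀`
  have hanti' : ∀ (k : ℕ) (v : Fin (k + 1) → ℝ), v ∈ Box γ k → ∀ x y : ℝ, 0 < x → x < y → y ≤ γ →
      1 / y ^ 2 - β k (Function.update v (Fin.last k) y) < 1 / x ^ 2 - β k (Function.update v (Fin.last k) x) :=
    fun k v hv x y hx hxy hyγ => hanti k v (box_mono hγle k hv) x y hx hxy (hyγ.trans hγle)
  have hcoop' : ∀ (k : ℕ) (v v' : Fin (k + 1) → ℝ), v ∈ Box γ k → v' ∈ Box γ k → (∀ i, v i ≤ v' i) →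
      v (Fin.last k) = v' (Fin.last k) → β k v ≤ β k v' :=
    fun k v v' hv hv' hle hlast => hcoop k v v' (box_mono hγle k hv) (box_mono hγle k hv') hle hlast
  intro n gs gs' hrg hrg' hI hI' h0
  exact strictOrder_of_cooperative hanti' hcoop' hrg hrg' hI hI' h0

/-- The same for the canonical construction `modelOf β` — the END binder as a property of a cooperative `β` ALONE. [cite: Balaban1987RG1, Thm 2 p.259] -/
theorem endpointExistence_modelOf_iff_topRuns_of_cooperative {β : HBeta} {γ₀ β' : ℝ} (hγ₀ : 0 < γ₀) (hβ' : 0 ≤ β')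
    (hcont : BetaContH γ₀ β) (hhi : BetaUpperH β' γ₀ β)
    (hanti : ∀ (k : ℕ) (v : Fin (k + 1) → ℝ), v ∈ Box γ₀ k → ∀ x y : ℝ, 0 < x → x < y → y ≤ γ₀ →
      1 / y ^ 2 - β k (Function.update v (Fin.last k) y) < 1 / x ^ 2 - β k (Function.update v (Fin.last k) x))
    (hcoop : ∀ (k : ℕ) (v v' : Fin (k + 1) → ℝ), v ∈ Box γ₀ k → v' ∈ Box γ₀ k → (∀ i, v i ≤ v' i) →
      v (Fin.last k) = v' (Fin.last k) → β k v ≤ β k v') :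
    EndpointExistence (modelOf β) ↔
      ∃ γ₂ : ℝ, 0 < γ₂ ∧ ∀ γ : ℝ, 0 < γ → γ ≤ γ₂ → ∃ gstar : ℝ, 0 < gstar ∧
        ∀ (n : ℕ) (gs : ℕ → ℝ), RGEqH n β gs → Step.InInterval γ n gs → ∀ k, k ≤ n → gs k = γ → gstar ≤ gs n :=
  endpointExistence_iff_topRuns_of_cooperative (modelOf_forwardGenerated β) (modelOf_haltsOutside β) (modelOf_curries β)
    hγ₀ hβ' hcont hhi hanti hcoop

/-! ## §3 The Lipschitz letter for the last coupling (v1.2, APPEND-ONLY): hypothesis (i) from a Lipschitz bound `≤ 2∕γ³` -/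

/-- Hypothesis (i) of `strictOrder_of_cooperative` from a LIPSCHITZ LETTER: if, for every in-box prefix `v`, the last-coupling section
`x ↦ β_{k+1}(v|_{last := x})` is Lipschitz on `]0,γ]` with constant `≤ 2∕γ³`, then each step map is increasing in the last coupling
(`EndTopRunCriterion.anti_of_lipschitz` applied to that one-variable section).  ANY fixed Lipschitz constant `Λ` qualifies on boxes with
`γ³ ≤ 2∕Λ`. [cite: Balaban1987RG1, §1 p.263] -/
theorem anti_of_lastLipschitz (hγ : 0 < γ)
    (hlip : ∀ (k : ℕ) (v : Fin (k + 1) → ℝ), v ∈ Box γ k → ∀ x y : ℝ, 0 < x → x ≤ γ → 0 < y → y ≤ γ →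
      |β k (Function.update v (Fin.last k) x) - β k (Function.update v (Fin.last k) y)| ≤ 2 / γ ^ 3 * |x - y|) :
    ∀ (k : ℕ) (v : Fin (k + 1) → ℝ), v ∈ Box γ k → ∀ x y : ℝ, 0 < x → x < y → y ≤ γ →
      1 / y ^ 2 - β k (Function.update v (Fin.last k) y) < 1 / x ^ 2 - β k (Function.update v (Fin.last k) x) := by
  intro k v hv x y hx hxy hyγ
  -- the one-variable section as a (trivially indexed) Markov family
  have h := anti_of_lipschitz (βM := fun _ z => β k (Function.update v (Fin.last k) z)) hγ
    (fun _ x' y' hx' hx'γ hy' hy'γ => hlip k v hv x' y' hx' hx'γ hy' hy'γ) 0 x y hx hxy hyγ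
  exact h

/-- **THE END CRITERION FOR COOPERATIVE FAMILIES, LIPSCHITZ LETTER**: as `endpointExistence_iff_topRuns_of_cooperative` with hypothesis (i)
replaced by «the last-coupling sections of β_{k+1} are Lipschitz on `]0,γ₀]` with constant `≤ 2∕γ₀³`» (then `≤ 2∕γ³` on every smaller box).
[cite: Balaban1987RG1, Thm 2 p.259 and §1 p.263] -/
theorem endpointExistence_iff_topRuns_of_cooperative_lipschitz {C : B12.Construction} {β : HBeta} (hgen : ForwardGenerated C β)
    (hhalt : HaltsOutside C β) (hcur : CurriesHBeta C β) {γ₀ β' : ℝ} (hγ₀ : 0 < γ₀) (hβ' : 0 ≤ β')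
    (hcont : BetaContH γ₀ β) (hhi : BetaUpperH β' γ₀ β)
    (hlip : ∀ (k : ℕ) (v : Fin (k + 1) → ℝ), v ∈ Box γ₀ k → ∀ x y : ℝ, 0 < x → x ≤ γ₀ → 0 < y → y ≤ γ₀ →
      |β k (Function.update v (Fin.last k) x) - β k (Function.update v (Fin.last k) y)| ≤ 2 / γ₀ ^ 3 * |x - y|)
    (hcoop : ∀ (k : ℕ) (v v' : Fin (k + 1) → ℝ), v ∈ Box γ₀ k → v' ∈ Box γ₀ k → (∀ i, v i ≤ v' i) →
      v (Fin.last k) = v' (Fin.last k) → β k v ≤ β k v') :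
    EndpointExistence C ↔
      ∃ γ₂ : ℝ, 0 < γ₂ ∧ ∀ γ : ℝ, 0 < γ → γ ≤ γ₂ → ∃ gstar : ℝ, 0 < gstar ∧
        ∀ (n : ℕ) (gs : ℕ → ℝ), RGEqH n β gs → Step.InInterval γ n gs → ∀ k, k ≤ n → gs k = γ → gstar ≤ gs n := by
  refine endpointExistence_iff_topRuns hgen hhalt hcur hγ₀ hβ' hcont hhi fun γ hγ hγle => ?_
  -- Lipschitz constant `2∕γ₀³ ≤ 2∕γ³` on the smaller box, then (i) at level γ; (ii) restricts by `box_mono`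
  have hlipγ : ∀ (k : ℕ) (v : Fin (k + 1) → ℝ), v ∈ Box γ k → ∀ x y : ℝ, 0 < x → x ≤ γ → 0 < y → y ≤ γ →
      |β k (Function.update v (Fin.last k) x) - β k (Function.update v (Fin.last k) y)| ≤ 2 / γ ^ 3 * |x - y| := by
    intro k v hv x y hx hxγ hy hyγ
    have h := hlip k v (box_mono hγle k hv) x y hx (hxγ.trans hγle) hy (hyγ.trans hγle)
    have hc : 2 / γ₀ ^ 3 ≤ 2 / γ ^ 3 :=
      div_le_div_of_nonneg_left (by norm_num) (by positivity) (pow_le_pow_left₀ hγ.le hγle 3)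
    exact h.trans (mul_le_mul_of_nonneg_right hc (abs_nonneg _))
  have hcoop' : ∀ (k : ℕ) (v v' : Fin (k + 1) → ℝ), v ∈ Box γ k → v' ∈ Box γ k → (∀ i, v i ≤ v' i) →
      v (Fin.last k) = v' (Fin.last k) → β k v ≤ β k v' :=
    fun k v v' hv hv' hle hlast => hcoop k v v' (box_mono hγle k hv) (box_mono hγle k hv') hle hlast
  intro n gs gs' hrg hrg' hI hI' h0
  exact strictOrder_of_cooperative (anti_of_lastLipschitz hγ hlipγ) hcoop' hrg hrg' hI hI' h0

end

end Summit.QuantumFields.BalabanUV.Gaps.EndTopRunCooperative
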